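import Mathlib
import Literature.NumberTheory.LFunctions.Zhang2022.SkeletonPartOneB
import Literature.NumberTheory.LFunctions.Zhang2022.SkeletonAssembly
import Literature.NumberTheory.LFunctions.Zhang2022.Section5Lemma54PartOne
import Literature.NumberTheory.LFunctions.Zhang2022.Section5Lemma57
import HarnessLib

/-!
# Zhang (2022) typed, §5 part C: Lemma 5.4 – Lemma 5.9 and their proofs' displayed steps
# (Z22 pp. 28–30, tex L1523–L1664; campaign file `TypedSection05C`, DAG nodes `Z22:Lem5.4` … `Z22:§5.u051`)

Topic `Literature/NumberTheory/LFunctions/Zhang2022` (Landau–Siegel audit tree; verdict-neutral).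
Y. Zhang, *Discrete mean estimates and the Landau–Siegel zero*, arXiv:2211.02515v1 (2022)
[Zhang2022LandauSiegel] — **an unrefereed manuscript under adjudication. Every `def … : Prop`
below is a CLAIM OF THE MANUSCRIPT (or the manuscript's PROOF of a claim, typed as an
implication `Ded…`), STATED NOT ASSERTED; nothing here asserts or denies its Theorems 1–2 or says
anything about Landau–Siegel zeros.** The few `theorem`s are kernel-checked bridges to decls the
tree already holds (no new named fact is introduced; D-0026).

STATEMENTS-FIRST typing (D-0069 / D-0014) of the slice tex L1523–L1664 of §5 "Some analytic
lemmas": every numbered statement and every displayed proof step, statement-exact, constants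
verbatim, one declaration per item, over the banked skeleton's objects
(`Skeleton.{ell, ell1, ell2, alpha, t0, s0, bigP, Chr, PsiOne, AssumptionA, ForAllLarge, deltaW,
DeltaW, omegaW, beta1, nu, gW, finsetOf}`). The five lemma STATEMENTS of the slice are already
banked skeleton nodes and are CITED, not re-typed: `Skeleton.Lemma54`, `Skeleton.Lemma55`
(`SkeletonPartOneB`; discharged: `Skeleton.lemma55_holds`), `Skeleton.Lemma56` (`lemma56_holds`),
`Skeleton.Lemma57` (`SkeletonPropositions`; `SkeletonAssembly.lemma57_holds`), `Skeleton.Lemma58`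
(`lemma58_holds`), `Skeleton.Lemma59 c′`.

Standing sentence of the slice (§5 p. 28, tex L1560): *"Throughout the rest of this paper we
assume that (A) holds. This assumption will not be repeated in the statements of the lemmas and
propositions in the sequel."* — Lemmas 5.5–5.8 are accordingly typed (in the skeleton and here)
with `Skeleton.AssumptionA D χ` as an antecedent, and — per the L1 lead's binding (A)-boundary
ruling (plan/L1/ASSIGNMENTS.md v1.2 §3: "(A) implicitly for EVERY node from tex L1560 on") — so is
every new node of this file from Lemma 5.5 on, INCLUDING the Lemma 5.9 block ((5.16) and the six
proof steps) and the two identities in the proofs of Lemmas 5.7/5.8 (unconditional in substance;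
the antecedent only weakens them to what is printed). The Lemma 5.4 block (tex ≤ L1559) is
unconditional. Caveat of record: the banked node `Skeleton.Lemma59 c′` itself carries no (A)
(typed before the ruling; `@sz-skel`); the proof node `Ded59` below concludes that banked node.
(v2 of this file = the (A)-repair of the nodes from tex L1560 on; v1 = p412074.)

Conventions (skel/INTERFACE.md §3): "`X ≪ Y`" ↦ `∃ C, ForAllLarge (… X ≤ C·Y)`;
"`X = Y + O(Z)`" ↦ `∃ C, ForAllLarge (… ‖X − Y‖ ≤ C·Z)`; "`O(ε)`", `ε = exp{−c𝓛¹⁰}` (§4 p. 19,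
tex L1062) ↦ `∃ c > 0, … + exp(−c𝓛¹⁰)`; "`o(1)`" ↦ `∀ ε > 0, ForAllLarge (… ≤ ε)`;
`ForAllLarge S` = "for all sufficiently large `D` and every real primitive `χ (mod D)`".

## Node table (DAG.tsv node ↦ declaration; `Skeleton.*` = banked, cited by FQN)

| node | locator | decl |
|---|---|---|
| `Z22:Lem5.4` | [Z22 p.28, tex L1523] | `Skeleton.Lemma54`; split `lemma54_iff : Lemma54 ↔ Lemma54i ∧ Lemma54ii` (PROVED) |
| `Z22:§5.u030` | [Z22 p.28, tex L1525] | `Lemma54i` (part (i)) |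
| `Z22:§5.u031` | [Z22 p.28, tex L1531] | `Lemma54ii` (part (ii)) |
| `Z22:Lem5.4.pf` | [Z22 p.28, tex L1536] | `Ded54` (Lemma 5.4 ⇐ (5.10), (5.14), Lemma 5.3) |
| `Z22:§5.u032` | [Z22 p.28, tex L1537] | `DeltaTwicePartialIntegration`; `deltaTwicePartialIntegration_holds` (PROVED) |
| `Z22:§5.u033` | [Z22 p.28, tex L1541] | `DeltaSecondDerivFormula`; `deltaSecondDerivFormula_holds` (PROVED) |
| `Z22:§5.u034` | [Z22 p.28, tex L1548] | `WindowPowerNearOne`; `windowPowerNearOne_holds` (PROVED) |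
| `Z22:§5.u035` | [Z22 p.28, tex L1552] | `OmegaLineIntegral`; `omegaLineIntegral_holds` (PROVED) |
| `Z22:Lem5.5` | [Z22 p.28, tex L1567] | `Skeleton.Lemma55` (discharged: `Skeleton.lemma55_holds`) |
| `Z22:(5.15)` | [Z22 p.28, (5.15), tex L1568] | `Eq515`; `eq515_of_lemma55`, `eq515_holds` (PROVED) |
| `Z22:§5.u036` | [Z22 p.28, tex L1572] | `region55` (object), `NoOtherZero55`; `noOtherZero55_of_lemma55`, `noOtherZero55_holds` (PROVED) |
| `Z22:Lem5.6`, `Z22:§5.u037` | [Z22 p.29, tex L1579–1580] | `Skeleton.Lemma56` (discharged: `Skeleton.lemma56_holds`) |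
| `Z22:Lem5.7`, `Z22:§5.u038` | [Z22 p.29, tex L1591–1592] | `Skeleton.Lemma57` (discharged: `Skeleton.lemma57_holds`) |
| `Z22:Lem5.7.pf` | [Z22 p.29, tex L1596] | `LeftSide57` (the undisplayed "left side = L′(1,χ) + o(1)"), `Ded57`; `ded57_holds` (PROVED) |
| `Z22:§5.u039` | [Z22 p.29, tex L1597] | `mellinLHS57`, `nuSum57` (objects), `MellinIdentity57`; `mellinIdentity57_holds` (PROVED, wave 2) |
| `Z22:§5.u040` | [Z22 p.29, tex L1601] | `NuSumLowerBound57`, `TotientLowerBound57`; `nuSumLowerBound57_holds` (PROVED, wave 2), `totientLowerBound57_holds` (PROVED) |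
| `Z22:Lem5.8`, `Z22:§5.u042` | [Z22 p.29, tex L1611, L1616] | `Skeleton.Lemma58` (discharged: `Skeleton.lemma58_holds`); `lemma58_iff` (PROVED) |
| `Z22:§5.u041` | [Z22 p.29, tex L1612] | `InRange58` (the hypothesis `α ≤ |s−1| ≤ 10α`) |
| `Z22:§5.u043` | [Z22 p.29, tex L1620] | `alpha2` (object `α₂ = 𝓛⁻¹⁵`) |
| `Z22:Lem5.8.pf` | [Z22 p.29, tex L1624] | `Ded58`; `ded58_holds` (PROVED) |
| `Z22:§5.u044` | [Z22 p.29, tex L1625] | `TaylorIdentity58`; `taylorIdentity58_holds` (PROVED, wave 2) |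
| `Z22:Lem5.9`, `Z22:§5.u045` | [Z22 p.29, tex L1632–1633] | `Skeleton.Lemma59 c′` |
| `Z22:Lem5.9.pf` | [Z22 p.29–30, tex L1637] | `Ded59 c′` (Lemma 5.9 ⇐ (5.16), Prop. 2.2) |
| `Z22:(5.16)` | [Z22 p.29–30, (5.16), tex L1638] | `zerosNear` (object), `Eq516` |
| `Z22:§5.u046` … `Z22:§5.u051` | [Z22 p.30, tex L1644–1664] | `Step59a c′` … `Step59f c′` (`InRange59`, `GapCond` objects) |

PROVED here (kernel, from tree theorems; 0 new facts): the four displayed steps of the proof of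
Lemma 5.4 at the manuscript's parameters (`…_holds` for u032–u035), the two halves of Lemma 5.5
((5.15), uniqueness) via `Skeleton.lemma55_holds_of` + `deuring_heilbronn_holds`, the proof nodes of
Lemmas 5.7 and 5.8 (their conclusions are tree theorems), `Σ_{n∣D} 1/n ≥ ½D/φ(D)`, and the
bookkeeping equivalences `lemma54_iff`, `lemma58_iff`. What is NOT here: proofs of the remaining
CLAIMs (`Lemma54i/ii`, `Ded54`, `MellinIdentity57`, `NuSumLowerBound57`, `LeftSide57`,
`TaylorIdentity58`, `Eq516`, `Ded59`, `Step59a–f` — dischargers' work, against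
`Zhang2022.Section5Lemma54*`, `Section5Lemma57`, `Section5Lemma58`, `Section5Lemma59*`,
`DirichletLogDerivDisc`); the §5 material before tex L1523 (`TypedSection05A/B`); any new named fact. Mis-references of the source in this slice, recorded
verbatim: Lemma 5.9's proof says "By (9.1)" (tex L1651) — (9.1) is §9's `Ξ₁₂ = 2Re Θ₁(…) + o(𝔓)`,
unrelated; evidently (5.16) is meant. Lemma 5.4 (i)'s proof prints `∫ … ds` for `dx` and `B` for
`𝓛₂` in the `Δ″` display (cf. (5.10)).

## References

* Y. Zhang, arXiv:2211.02515v1 (2022), §5 pp. 28–30: Lemmas 5.4–5.9, (5.14)–(5.16); §4 p. 18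
  (4.1) (`g`, `ω₁`); §2 (2.10), (2.13), (2.15). [cite: Zhang2022LandauSiegel, §5 Lemmas 5.4–5.9]
* H. L. Montgomery, R. C. Vaughan, *Multiplicative Number Theory I* (2007), Lemma 12.1 (the
  classical partial-fraction formula behind "(5.16) it is known"; in the tree in disc form as
  `Literature.NumberTheory.LFunctions.DirichletDisc.exists_norm_logDeriv_sub_sum_le`).
  [cite: MontgomeryVaughan2007, Lemma 12.1]
-/

noncomputable section

open Complex Real Filter Topology Set MeasureTheory

namespace Literature.NumberTheory.LFunctions.Zhang2022.Typed.Section05C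

open Literature.NumberTheory.LFunctions.Zhang2022.Skeleton

/-! ## Lemma 5.4 (p. 28): the node `Skeleton.Lemma54`, its two parts, and its proof's displays -/

/-- **Lemma 5.4 (i)** (DAG node `Z22:§5.u030`): "If `1/2 ≤ σ ≤ 2`, then `δ(s) ≪ 𝓛ᶜ|s|⁻²`"
(`c` an unspecified absolute exponent; `δ` = (5.14) = `Skeleton.deltaW`). CLAIM — part (i) of the
banked node `Skeleton.Lemma54` (`lemma54_iff`). [cite: Zhang2022LandauSiegel, §5 Lemma 5.4 (i) p.28]
[Z22 p.28, tex L1525] -/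
def Lemma54i : Prop :=
  ∃ k : ℕ, ∃ C : ℝ, ForAllLarge fun D _ _ => ∀ s : ℂ,
    1 / 2 ≤ s.re → s.re ≤ 2 → ‖deltaW D s‖ ≤ C * ell D ^ k * ‖s‖⁻¹ ^ 2

/-- **Lemma 5.4 (ii)** (DAG node `Z22:§5.u031`): "If `|s − 1| < 10α`, then `δ(s) = 1 + O(α log 𝓛)`."
CLAIM — part (ii) of the banked node `Skeleton.Lemma54` (`lemma54_iff`).
[cite: Zhang2022LandauSiegel, §5 Lemma 5.4 (ii) p.28] [Z22 p.28, tex L1531] -/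
def Lemma54ii : Prop :=
  ∃ C : ℝ, ForAllLarge fun D _ _ => ∀ s : ℂ,
    ‖s - 1‖ < 10 * alpha D → ‖deltaW D s - 1‖ ≤ C * alpha D * Real.log (ell D)

/-- `log D ≥ a` once `D ≥ ⌈eᵃ⌉`. [folklore] -/
private theorem le_ell_of_ceil_exp_le {a : ℝ} {D : ℕ} (hD : ⌈Real.exp a⌉₊ ≤ D) : a ≤ ell D := by
  have h : Real.exp a ≤ D := le_trans (Nat.le_ceil _) (by exact_mod_cast hD)
  exact (Real.le_log_iff_exp_le (lt_of_lt_of_le (Real.exp_pos _) h)).mpr h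

/-- `log D > 1` for `D ≥ 3`. [folklore] -/
private theorem one_lt_ell {D : ℕ} (hD : 3 ≤ D) : 1 < ell D := by
  have hD' : (3 : ℝ) ≤ D := by exact_mod_cast hD
  calc (1 : ℝ) < Real.log 3 := by
        rw [Real.lt_log_iff_exp_lt (by norm_num)]
        exact Real.exp_one_lt_d9.trans (by norm_num)
    _ ≤ Real.log D := Real.log_le_log (by norm_num) hD'

/-- `𝓛₂ = 𝓛⁴⁰⁰ ≥ 1` for `D ≥ 3`. [folklore] -/
private theorem one_le_ell2 {D : ℕ} (hD : 3 ≤ D) : 1 ≤ ell2 D :=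
  one_le_pow₀ (one_lt_ell hD).le

/-- **The banked node `Skeleton.Lemma54` is exactly parts (i) ∧ (ii)** (DAG node `Z22:Lem5.4`;
the node states both parts under one pair of constants — split here so that (i) and (ii) can be
discharged separately). [cite: Zhang2022LandauSiegel, §5 Lemma 5.4 p.28] [Z22 p.28, tex L1523] -/
theorem lemma54_iff : Skeleton.Lemma54 ↔ Lemma54i ∧ Lemma54ii := by
  constructor
  · rintro ⟨k, C, D₀, h⟩
    exact ⟨⟨k, C, D₀, fun D _ χ hD hq hp s h1 h2 => ((h D χ hD hq hp s).1 h1 h2)⟩,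
      ⟨C, D₀, fun D _ χ hD hq hp s h3 => ((h D χ hD hq hp s).2 h3)⟩⟩
  · rintro ⟨⟨k, C₁, D₁, h₁⟩, ⟨C₂, D₂, h₂⟩⟩
    refine ⟨k, max C₁ C₂, max (max D₁ D₂) ⌈Real.exp 3⌉₊, fun D _ χ hD hq hp s => ⟨?_, ?_⟩⟩
    · intro h1 h2
      have hD₁ : D₁ ≤ D := le_trans (le_trans (le_max_left _ _) (le_max_left _ _)) hD
      have hnn : 0 ≤ ell D ^ k * ‖s‖⁻¹ ^ 2 :=
        mul_nonneg (pow_nonneg (Real.log_natCast_nonneg D) k) (by positivity)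
      calc ‖deltaW D s‖ ≤ C₁ * ell D ^ k * ‖s‖⁻¹ ^ 2 := h₁ D χ hD₁ hq hp s h1 h2
        _ = C₁ * (ell D ^ k * ‖s‖⁻¹ ^ 2) := by ring
        _ ≤ max C₁ C₂ * (ell D ^ k * ‖s‖⁻¹ ^ 2) :=
            mul_le_mul_of_nonneg_right (le_max_left _ _) hnn
        _ = max C₁ C₂ * ell D ^ k * ‖s‖⁻¹ ^ 2 := by ring
    · intro h3
      have hD₂ : D₂ ≤ D := le_trans (le_trans (le_max_right _ _) (le_max_left _ _)) hD
      have hℓ : (3 : ℝ) ≤ ell D := le_ell_of_ceil_exp_le (le_trans (le_max_right _ _) hD)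
      have hα : 0 ≤ alpha D := by
        rw [alpha, bigP, Real.log_exp, ell]
        exact div_nonneg Real.pi_pos.le (pow_nonneg (Real.log_natCast_nonneg D) 9)
      have hlog : 0 ≤ Real.log (ell D) := Real.log_nonneg (by linarith)
      have hnn : 0 ≤ alpha D * Real.log (ell D) := mul_nonneg hα hlog
      calc ‖deltaW D s - 1‖ ≤ C₂ * alpha D * Real.log (ell D) := h₂ D χ hD₂ hq hp s h3
        _ = C₂ * (alpha D * Real.log (ell D)) := by ring
        _ ≤ max C₁ C₂ * (alpha D * Real.log (ell D)) :=
            mul_le_mul_of_nonneg_right (le_max_right _ _) hnn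
        _ = max C₁ C₂ * alpha D * Real.log (ell D) := by ring

/-- **Proof of Lemma 5.4** (DAG node `Z22:Lem5.4.pf`, p. 28): the manuscript deduces Lemma 5.4 from
(5.10) (the integral representation of `Δ` — the tree's `Lemma53.Delta57_eq_Delta510`), (5.14) (the
definition of `δ`) and Lemma 5.3 ("some upper bounds for `Δ″(x)` analogous to Lemma 5.3"; "By
Lemma 5.3, … the part `|x − t₀| ≥ 𝓛₁` contributes `O(ε)`"), through the four displayed steps
`DeltaTwicePartialIntegration`, `DeltaSecondDerivFormula`, `WindowPowerNearOne`,
`OmegaLineIntegral` below. Typed as the implication Lemma 5.3 ⇒ Lemma 5.4 between the banked nodes.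
CLAIM (proof node). [cite: Zhang2022LandauSiegel, §5 Lemma 5.4 (proof) p.28] [Z22 p.28, tex L1536] -/
def Ded54 : Prop := Skeleton.Lemma53 → Skeleton.Lemma54

/-- **"Using partial integration twice we obtain `δ(s) = (1/(s(s+1)))∫₀^∞ Δ″(x)x^{s+1} dx`"**
(DAG node `Z22:§5.u032`; the source prints `ds`), in the proof of Lemma 5.4 (i) (`1/2 ≤ σ ≤ 2`);
`Δ″` = the second derivative of `Δ` (5.7)/(5.10) = `Skeleton.DeltaW D`. CLAIM — PROVED below
(`deltaTwicePartialIntegration_holds`, from the tree's free-parameter `Lemma53.delta514_eq`). [cite: Zhang2022LandauSiegel, §5 Lemma 5.4 (proof) p.28]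
[Z22 p.28, tex L1537] -/
def DeltaTwicePartialIntegration : Prop :=
  ∀ D : ℕ, 3 ≤ D → ∀ s : ℂ, 1 / 2 ≤ s.re → s.re ≤ 2 →
    deltaW D s = 1 / (s * (s + 1)) *
      ∫ x in Set.Ioi (0 : ℝ), deriv (deriv (DeltaW D)) x * (x : ℂ) ^ (s + 1)

/-- **"By (5.10) we have `Δ″(x) = −4π²∫_{−∞}^{∞} (e^u − 1)² exp{s₀u − B²u² − 2πix(e^u − 1)} du`"**
(DAG node `Z22:§5.u033`; the printed `B` is `𝓛₂` of (5.10), `s₀ = 1/2 + 2πit₀`), for `x > 0`.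
CLAIM — PROVED below (`deltaSecondDerivFormula_holds`, from the tree's `Lemma53.deriv_deriv_Delta510`).
[cite: Zhang2022LandauSiegel, §5 Lemma 5.4 (proof) p.28] [Z22 p.28, tex L1541] -/
def DeltaSecondDerivFormula : Prop :=
  ∀ D : ℕ, 3 ≤ D → ∀ x : ℝ, 0 < x →
    deriv (deriv (DeltaW D)) x =
      -4 * π ^ 2 * ∫ u : ℝ, (((Real.exp u - 1) ^ 2 : ℝ) : ℂ) *
        cexp (s0 D * u - (ell2 D : ℂ) ^ 2 * (u : ℂ) ^ 2 - 2 * π * I * x * ((Real.exp u - 1 : ℝ) : ℂ))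

/-- `Δ` of (5.6)–(5.7) (`Skeleton.DeltaW`) agrees with the integral (5.10) (`Lemma53.Delta510`) near
every `x > 0` (the tree's `Lemma53.Delta57_eq_Delta510`). [cite: Zhang2022LandauSiegel, §5 (5.10) p.27] -/
private theorem deltaW_eventuallyEq {D : ℕ} (hD : 3 ≤ D) {x : ℝ} (hx : 0 < x) :
    DeltaW D =ᶠ[𝓝 x] Lemma53.Delta510 (ell2 D) (t0 D) := by
  have hℓ : 0 < ell2 D := lt_of_lt_of_le one_pos (one_le_ell2 hD)
  filter_upwards [Ioi_mem_nhds hx] with y hy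
  exact Lemma53.Delta57_eq_Delta510 hℓ (t0 D) hy

/-- `Δ″(x)` is the tree's `Lemma53.phaseInt 2` for `x > 0`. [cite: Zhang2022LandauSiegel, §5 Lemma 5.4 (proof) p.28] -/
private theorem deriv_deriv_deltaW {D : ℕ} (hD : 3 ≤ D) {x : ℝ} (hx : 0 < x) :
    deriv (deriv (DeltaW D)) x = Lemma53.phaseInt 2 (ell2 D) (t0 D) x := by
  have hℓ : 0 < ell2 D := lt_of_lt_of_le one_pos (one_le_ell2 hD)
  rw [(deltaW_eventuallyEq hD hx).deriv.deriv_eq, Lemma53.deriv_Delta510 hℓ.ne' (t0 D),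
    (Lemma53.hasDerivAt_phaseInt hℓ.ne' 1 (t0 D) x).deriv]

/-- **The twice-partial-integration identity of the proof of Lemma 5.4 (i) HOLDS** (DAG node
`Z22:§5.u032` PROVED), by the tree's `Lemma53.delta514_eq` (valid for every `σ > 0`).
[cite: Zhang2022LandauSiegel, §5 Lemma 5.4 (proof) p.28] -/
theorem deltaTwicePartialIntegration_holds : DeltaTwicePartialIntegration := by
  intro D hD s hs1 _
  have hs : 0 < s.re := by linarith
  rw [deltaW, Lemma53.delta514_eq (one_le_ell2 hD) (t0 D) hs]
  congr 1
  refine setIntegral_congr_fun measurableSet_Ioi fun x hx => ?_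
  rw [deriv_deriv_deltaW hD hx]

/-- **The `Δ″` formula of the proof of Lemma 5.4 (i) HOLDS** (DAG node `Z22:§5.u033` PROVED), by the
tree's `Lemma53.deriv_deriv_Delta510`. [cite: Zhang2022LandauSiegel, §5 Lemma 5.4 (proof) p.28] -/
theorem deltaSecondDerivFormula_holds : DeltaSecondDerivFormula := by
  intro D hD x hx
  have hℓ : 0 < ell2 D := lt_of_lt_of_le one_pos (one_le_ell2 hD)
  rw [(deltaW_eventuallyEq hD hx).deriv.deriv_eq, Lemma53.deriv_deriv_Delta510 hℓ.ne' (t0 D) x]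
  have e : -(4 * (π : ℂ) ^ 2) = -4 * π ^ 2 := by ring
  rw [e]
  congr 1
  refine integral_congr_ae (Eventually.of_forall fun u => ?_)
  simp only [Lemma53.phase_def, s0, SmoothWeight.s0_def]
  push_cast
  ring

/-- **"For `|x − t₀| < 𝓛₁` we have `x^{s−1} = 1 + O(α log 𝓛)`"** (DAG node `Z22:§5.u034`), in the
proof of Lemma 5.4 (ii) (`|s − 1| < 10α`). CLAIM — PROVED below (`windowPowerNearOne_holds`).
[cite: Zhang2022LandauSiegel, §5 Lemma 5.4 (proof) p.28] [Z22 p.28, tex L1548] -/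
def WindowPowerNearOne : Prop :=
  ∃ C : ℝ, ForAllLarge fun D _ _ => ∀ s : ℂ, ‖s - 1‖ < 10 * alpha D →
    ∀ x : ℝ, |x - t0 D| < ell1 D → ‖(x : ℂ) ^ (s - 1) - 1‖ ≤ C * alpha D * Real.log (ell D)

/-- **"Since `∫₀^∞ ω(1/2 + 2πix) dx = 1 + O(ε)`"** (DAG node `Z22:§5.u035`; `ω` = (2.15) =
`Skeleton.omegaW`, `ε = exp{−c𝓛¹⁰}`). CLAIM — PROVED below with `c = 1` (`omegaLineIntegral_holds`).
[cite: Zhang2022LandauSiegel, §5 Lemma 5.4 (proof) p.28] [Z22 p.28, tex L1552] -/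
def OmegaLineIntegral : Prop :=
  ∃ c : ℝ, 0 < c ∧ ForAllLarge fun D _ _ =>
    ‖(∫ x in Set.Ioi (0 : ℝ), omegaW D (1 / 2 + 2 * π * x * I)) - 1‖ ≤ Real.exp (-c * ell D ^ 10)

/-- **"`x^{s−1} = 1 + O(α log 𝓛)` on the window" HOLDS** (DAG node `Z22:§5.u034` PROVED): with
`C = 10400`, for `D ≥ ⌈e⁴⌉` — `|x − t₀| < 𝓛₁` forces `1 ≤ x ≤ 2𝓛⁵¹⁹`, so `|log x| ≤ 520 log 𝓛`,
`|s − 1|·|log x| ≤ 5200α log 𝓛 ≤ 1`, and the tree's `Lemma53.norm_cpow_sub_one_le` applies.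
[cite: Zhang2022LandauSiegel, §5 Lemma 5.4 (proof) p.28] -/
theorem windowPowerNearOne_holds : WindowPowerNearOne := by
  refine ⟨2 * (10 * 520), ⌈Real.exp 4⌉₊, fun D _ χ hD _ _ s hs x hx => ?_⟩
  have hℓ4 : 4 ≤ ell D := le_ell_of_ceil_exp_le hD
  have hℓ0 : 0 < ell D := by linarith
  have hα : alpha D = π / ell D ^ 9 := by rw [alpha, bigP, Real.log_exp]
  have hα0 : 0 < alpha D := by rw [hα]; positivity
  -- the window: `1 ≤ x ≤ 2𝓛⁵¹⁹`
  have hx' := abs_lt.mp hx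
  rw [t0, ell1] at hx'
  have hpow : ell D ^ 405 + 1 ≤ ell D ^ 519 := by
    have h1 : (2 : ℝ) * ell D ^ 405 ≤ ell D ^ 519 := by
      have : (2 : ℝ) ≤ ell D ^ 114 :=
        le_trans (by linarith) (le_self_pow₀ (by linarith : (1 : ℝ) ≤ ell D) (by norm_num))
      calc (2 : ℝ) * ell D ^ 405 ≤ ell D ^ 114 * ell D ^ 405 := by gcongr
        _ = ell D ^ 519 := by ring
    have h2 : (1 : ℝ) ≤ ell D ^ 405 := one_le_pow₀ (by linarith)
    linarith
  have hx1 : 1 ≤ x := by linarith [hx'.1]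
  have hx0 : 0 < x := by linarith
  have hx2 : x ≤ 2 * ell D ^ 519 := by
    have : ell D ^ 405 ≤ ell D ^ 519 := pow_le_pow_right₀ (by linarith) (by norm_num)
    linarith [hx'.2]
  have hlogℓ : 0 < Real.log (ell D) := Real.log_pos (by linarith)
  have hlogx : |Real.log x| ≤ 520 * Real.log (ell D) := by
    rw [abs_of_nonneg (Real.log_nonneg hx1)]
    have h2 : Real.log 2 ≤ Real.log (ell D) := Real.log_le_log (by norm_num) (by linarith)
    calc Real.log x ≤ Real.log (2 * ell D ^ 519) := Real.log_le_log hx0 hx2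
      _ = Real.log 2 + 519 * Real.log (ell D) := by
          rw [Real.log_mul (by norm_num) (by positivity), Real.log_pow]; push_cast; ring
      _ ≤ 520 * Real.log (ell D) := by linarith
  -- `‖s − 1‖·|log x| ≤ 10α·520 log 𝓛 ≤ 1`
  have hprod : ‖s - 1‖ * |Real.log x| ≤ 10 * alpha D * (520 * Real.log (ell D)) :=
    mul_le_mul hs.le hlogx (abs_nonneg _) (by positivity)
  have hsmall : 10 * alpha D * (520 * Real.log (ell D)) ≤ 1 := by
    rw [hα]
    have hlog : Real.log (ell D) ≤ ell D := (Real.log_le_sub_one_of_pos hℓ0).trans (by linarith)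
    have h8 : (5200 * 4 : ℝ) ≤ ell D ^ 8 :=
      le_trans (by norm_num) (pow_le_pow_left₀ (by norm_num) hℓ4 8)
    have hπ : π < 4 := Real.pi_lt_four
    rw [show 10 * (π / ell D ^ 9) * (520 * Real.log (ell D))
        = 5200 * π * Real.log (ell D) / ell D ^ 9 by ring, div_le_one (by positivity)]
    calc 5200 * π * Real.log (ell D) ≤ 5200 * 4 * ell D := by gcongr
      _ ≤ ell D ^ 8 * ell D := by gcongr
      _ = ell D ^ 9 := by ring
  calc ‖(x : ℂ) ^ (s - 1) - 1‖ ≤ 2 * (‖s - 1‖ * |Real.log x|) :=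
        Lemma53.norm_cpow_sub_one_le hx0 (hprod.trans hsmall)
    _ ≤ 2 * (10 * alpha D * (520 * Real.log (ell D))) := by gcongr
    _ = 2 * (10 * 520) * alpha D * Real.log (ell D) := by ring

/-- **"`∫₀^∞ ω(1/2+2πix) dx = 1 + O(ε)`" HOLDS** (DAG node `Z22:§5.u035` PROVED), with `c = 1`:
`∫_ℝ ω = 1` exactly (`SmoothWeight.integral_omegaLine`) and the left tail is
`≤ ½exp{−(πt₀/𝓛₂)²} = ½exp{−π²𝓛²³⁸} ≤ exp{−𝓛¹⁰}` (`SmoothWeight.integral_omegaLine_Iic_le`).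
[cite: Zhang2022LandauSiegel, §5 Lemma 5.4 (proof) p.28] -/
theorem omegaLineIntegral_holds : OmegaLineIntegral := by
  refine ⟨1, one_pos, ⌈Real.exp 1⌉₊, fun D _ χ hD _ _ => ?_⟩
  have hℓ1 : 1 ≤ ell D := le_ell_of_ceil_exp_le hD
  have hℓ0 : 0 < ell D := by linarith
  have hℓ2 : 0 < ell2 D := by unfold ell2; positivity
  have ht0 : 0 ≤ t0 D := by unfold t0; positivity
  have hpt : ∀ x : ℝ, omegaW D (1 / 2 + 2 * π * x * I)
      = (SmoothWeight.omegaLine (ell2 D) (t0 D) x : ℂ) :=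
    fun x => SmoothWeight.omega_half_eq hℓ2.ne' (t0 D) x
  simp_rw [hpt]
  rw [integral_complex_ofReal]
  have hint := SmoothWeight.integrable_omegaLine hℓ2 (t0 D)
  have hsplit :=
    intervalIntegral.integral_Iic_add_Ioi (b := (0 : ℝ)) hint.integrableOn hint.integrableOn
  rw [SmoothWeight.integral_omegaLine hℓ2] at hsplit
  have hIoi : ∫ x in Set.Ioi (0 : ℝ), SmoothWeight.omegaLine (ell2 D) (t0 D) x
      = 1 - ∫ x in Set.Iic (0 : ℝ), SmoothWeight.omegaLine (ell2 D) (t0 D) x := by linarith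
  have htail := SmoothWeight.integral_omegaLine_Iic_le hℓ2 ht0
  have htail0 : 0 ≤ ∫ x in Set.Iic (0 : ℝ), SmoothWeight.omegaLine (ell2 D) (t0 D) x :=
    setIntegral_nonneg measurableSet_Iic fun x _ => SmoothWeight.omegaLine_nonneg hℓ2 _ x
  rw [hIoi]
  have e : (((1 - ∫ x in Set.Iic (0 : ℝ), SmoothWeight.omegaLine (ell2 D) (t0 D) x : ℝ) : ℂ) - 1)
      = -(((∫ x in Set.Iic (0 : ℝ), SmoothWeight.omegaLine (ell2 D) (t0 D) x : ℝ) : ℂ)) := by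
    push_cast; ring
  rw [e, norm_neg, Complex.norm_real, Real.norm_of_nonneg htail0]
  have hexp : (π * t0 D / ell2 D) ^ 2 = π ^ 2 * ell D ^ 238 := by
    have h : ell D ^ 519 / ell D ^ 400 = ell D ^ 119 := by
      rw [div_eq_iff (by positivity)]; ring
    rw [t0, ell2, mul_div_assoc, h]; ring
  calc ∫ x in Set.Iic (0 : ℝ), SmoothWeight.omegaLine (ell2 D) (t0 D) x
      ≤ 1 / 2 * Real.exp (-(π * t0 D / ell2 D) ^ 2) := htail
    _ ≤ Real.exp (-(π * t0 D / ell2 D) ^ 2) := by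
        linarith [Real.exp_pos (-(π * t0 D / ell2 D) ^ 2)]
    _ ≤ Real.exp (-1 * ell D ^ 10) := by
        apply Real.exp_le_exp.mpr
        rw [hexp]
        have h1 : ell D ^ 10 ≤ ell D ^ 238 := pow_le_pow_right₀ hℓ1 (by norm_num)
        have h2 : ell D ^ 238 ≤ π ^ 2 * ell D ^ 238 := by
          have hπ : (1 : ℝ) ≤ π ^ 2 := by nlinarith [Real.pi_gt_three]
          nlinarith [pow_nonneg hℓ0.le 238]
        linarith

/-! ## Lemma 5.5 (p. 28, under (A)): the node `Skeleton.Lemma55`, (5.15) and the region -/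

/-- **(5.15)** (DAG node `Z22:(5.15)`): under (A), "`L(s,χ)` has a simple real zero `ρ̃` such that
`1 − ρ̃ = O(𝓛⁻²⁰²²)`" — the existence half of Lemma 5.5. CLAIM; it is a projection of the banked
node `Skeleton.Lemma55` (`eq515_of_lemma55`) and so a theorem of the tree (`eq515_holds`).
[cite: Zhang2022LandauSiegel, §5 Lemma 5.5 (5.15) p.28] [Z22 p.28, (5.15), tex L1568] -/
def Eq515 : Prop :=
  ∃ C : ℝ, ForAllLarge fun D _ χ => AssumptionA D χ →
    ∃ ρt : ℝ, χ.LFunction ρt = 0 ∧ deriv χ.LFunction ρt ≠ 0 ∧ 0 ≤ 1 - ρt ∧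
      1 - ρt ≤ C * (ell D ^ 2022)⁻¹

/-- **The region of Lemma 5.5** (DAG node `Z22:§5.u036`, the display "`σ > 1 − 2𝓛⁻¹, |t| < 2D`").
[cite: Zhang2022LandauSiegel, §5 Lemma 5.5 p.28] [Z22 p.28, tex L1572] -/
def region55 (D : ℕ) : Set ℂ := {s | 1 - 2 / ell D < s.re ∧ |s.im| < 2 * D}

/-- **"and `L(s,χ)` has no other zeros in the region `σ > 1 − 2𝓛⁻¹, |t| < 2D`"** (DAG node
`Z22:§5.u036`; under (A)): all zeros of `L(s,χ)` in `region55 D` coincide with one real number —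
the uniqueness half of Lemma 5.5. CLAIM; a projection of `Skeleton.Lemma55`
(`noOtherZero55_of_lemma55`), hence a theorem of the tree (`noOtherZero55_holds`).
[cite: Zhang2022LandauSiegel, §5 Lemma 5.5 p.28] [Z22 p.28, tex L1572] -/
def NoOtherZero55 : Prop :=
  ForAllLarge fun D _ χ => AssumptionA D χ →
    ∃ ρt : ℝ, ∀ s ∈ region55 D, χ.LFunction s = 0 → s = ρt

/-- (5.15) is a projection of the banked node `Skeleton.Lemma55`.
[cite: Zhang2022LandauSiegel, §5 Lemma 5.5 (5.15) p.28] -/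
theorem eq515_of_lemma55 (h : Skeleton.Lemma55) : Eq515 := by
  obtain ⟨C, D₀, h⟩ := h
  refine ⟨C, D₀, fun D _ χ hD hq hp hA => ?_⟩
  obtain ⟨ρt, h0, hder, hge, hle, -⟩ := h D χ hD hq hp hA
  exact ⟨ρt, h0, hder, hge, hle⟩

/-- The uniqueness clause is a projection of the banked node `Skeleton.Lemma55`.
[cite: Zhang2022LandauSiegel, §5 Lemma 5.5 p.28] -/
theorem noOtherZero55_of_lemma55 (h : Skeleton.Lemma55) : NoOtherZero55 := by
  obtain ⟨C, D₀, h⟩ := h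
  refine ⟨D₀, fun D _ χ hD hq hp hA => ?_⟩
  obtain ⟨ρt, -, -, -, -, huniq⟩ := h D χ hD hq hp hA
  exact ⟨ρt, fun s hs hz => huniq s hz hs.1 hs.2⟩

/-- **(5.15) holds in the tree** (via `Skeleton.lemma55_holds_of` and the tree's proof of the
Deuring–Heilbronn phenomenon `deuring_heilbronn_holds`). [cite: Zhang2022LandauSiegel, §5 Lemma 5.5 (5.15) p.28] -/
theorem eq515_holds : Eq515 :=
  eq515_of_lemma55 (Skeleton.lemma55_holds_of deuring_heilbronn_holds)

/-- **The uniqueness clause of Lemma 5.5 holds in the tree** (same route).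
[cite: Zhang2022LandauSiegel, §5 Lemma 5.5 p.28] -/
theorem noOtherZero55_holds : NoOtherZero55 :=
  noOtherZero55_of_lemma55 (Skeleton.lemma55_holds_of deuring_heilbronn_holds)

/-! ## Lemma 5.6 (p. 29, under (A))

DAG nodes `Z22:Lem5.6` and `Z22:§5.u037` (its one display) are the banked node `Skeleton.Lemma56`
(`SkeletonPartOneB`), stated there without proof in the source and DISCHARGED in the tree
(`Skeleton.lemma56_holds`); nothing to add. [cite: Zhang2022LandauSiegel, §5 Lemma 5.6 p.29] -/

/-! ## Lemma 5.7 (p. 29, under (A)): `L′(1,χ) ≫ D/φ(D)` — the node `Skeleton.Lemma57` and its proof -/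

/-- The left side of the identity in the proof of Lemma 5.7 (DAG node `Z22:§5.u039`):
`(1/2πi)∫_{(1)} ζ(1+s)L(1+s,χ)D^{4s}ω₁(s) ds/s`, `ω₁(w) = exp{w²/(4𝓛³⁰)}` (§4 p. 18; the tree's
`GaussWeight.omega1 (𝓛³⁰)`), written as `(1/2π)∫_ℝ (…)(1+it) dt` on the line `Re s = 1`.
[cite: Zhang2022LandauSiegel, §5 Lemma 5.7 (proof) p.29] [Z22 p.29, tex L1597] -/
def mellinLHS57 {D : ℕ} [NeZero D] (χ : DirichletCharacter ℂ D) : ℂ :=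
  (1 / (2 * π) : ℂ) * ∫ t : ℝ,
    riemannZeta (1 + (1 + t * I)) * χ.LFunction (1 + (1 + t * I)) *
      (D : ℂ) ^ (4 * (1 + (t : ℂ) * I)) * GaussWeight.omega1 (ell D ^ 30) (1 + t * I) / (1 + t * I)

/-- The right side of the identity in the proof of Lemma 5.7 (DAG node `Z22:§5.u039`):
`Σ_n ν(n)n⁻¹g(D⁴/n)`, `ν = 1 ∗ χ` (§3; `Skeleton.nu`), `g` = (4.1) (`Skeleton.gW`, `Λ = 𝓛³⁰`);
the `n = 0` term is `0`. [cite: Zhang2022LandauSiegel, §5 Lemma 5.7 (proof) p.29] [Z22 p.29, tex L1597] -/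
def nuSum57 {D : ℕ} [NeZero D] (χ : DirichletCharacter ℂ D) : ℂ := ∑' n : ℕ, nu χ n / (n : ℂ) * (gW D ((D : ℝ) ^ 4 / n) : ℂ)

/-- **The identity of the proof of Lemma 5.7** (DAG node `Z22:§5.u039`):
"`(1/2πi)∫_{(1)} ζ(1+s)L(1+s,χ)(D^{4s}ω₁(s)/s) ds = Σ_n (ν(n)/n)g(D⁴/n)`" (Mellin inversion with the
weight `g` of (4.1), for `ζ(s)L(s,χ) = Σ ν(n)n⁻ˢ`). CLAIM (an identity, unconditional in substance;
typed in the house style under the blanket (A) of tex L1560, which only weakens it).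
[cite: Zhang2022LandauSiegel, §5 Lemma 5.7 (proof) p.29] [Z22 p.29, tex L1597] -/
def MellinIdentity57 : Prop :=
  ForAllLarge fun D _ χ => AssumptionA D χ → mellinLHS57 χ = nuSum57 χ

/-- **"The right side … is `≫ Σ_{n∣D} 1/n` … since `ν(n) = 1` if `n ∣ D`"** (DAG node `Z22:§5.u040`,
first inequality; for the real character `χ`, all `ν(n) ≥ 0`). CLAIM.
[cite: Zhang2022LandauSiegel, §5 Lemma 5.7 (proof) p.29] [Z22 p.29, tex L1601] -/
def NuSumLowerBound57 : Prop :=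
  ∃ c : ℝ, 0 < c ∧ ForAllLarge fun D _ χ => AssumptionA D χ →
    c * ∑ n ∈ Nat.divisors D, (1 : ℝ) / n ≤ (nuSum57 χ).re

/-- **"`Σ_{n∣D} 1/n ≫ D/φ(D)`"** (DAG node `Z22:§5.u040`, second inequality; pure arithmetic in `D`,
typed in the house style under the blanket (A)). CLAIM — and a theorem of the tree with `c = 1/2`
for every `D ≠ 0` (`totientLowerBound57_holds`).
[cite: Zhang2022LandauSiegel, §5 Lemma 5.7 (proof) p.29] [Z22 p.29, tex L1601] -/
def TotientLowerBound57 : Prop :=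
  ∃ c : ℝ, 0 < c ∧ ForAllLarge fun D _ χ => AssumptionA D χ →
    c * ((D : ℝ) / Nat.totient D) ≤ ∑ n ∈ Nat.divisors D, (1 : ℝ) / n

/-- `Σ_{n∣D} 1/n ≥ ½·D/φ(D)` — the tree's `Lemma57.half_self_div_totient_le_sum_divisors`.
[cite: Zhang2022LandauSiegel, §5 Lemma 5.7 (proof) p.29] -/
theorem totientLowerBound57_holds : TotientLowerBound57 :=
  ⟨1 / 2, by norm_num, 1, fun D _ _ hD _ _ _ =>
    Lemma57.half_self_div_totient_le_sum_divisors (D := D) (by omega)⟩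

/-- **"while the left side is, by moving the line of integration to the left appropriately and
applying (A), equal to `L′(1,χ) + o(1)`"** (the undisplayed second half of the proof of Lemma 5.7,
DAG node `Z22:Lem5.7.pf`). CLAIM. [cite: Zhang2022LandauSiegel, §5 Lemma 5.7 (proof) p.29]
[Z22 p.29, tex L1604] -/
def LeftSide57 : Prop :=
  ∀ ε : ℝ, 0 < ε → ForAllLarge fun D _ χ => AssumptionA D χ →
    ‖mellinLHS57 χ - deriv χ.LFunction 1‖ ≤ ε

/-- **Proof of Lemma 5.7** (DAG node `Z22:Lem5.7.pf`): Lemma 5.7 from the identity, the two lower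
bounds and the evaluation of the left side. CLAIM (proof node) — trivially a theorem since its
conclusion `Skeleton.Lemma57` is (`ded57_holds`; the tree's proof `Zhang2022.Lemma57.lemma_5_7` runs
the same argument with the weight `e^{−n/D⁴}` in place of `g(D⁴/n)`).
[cite: Zhang2022LandauSiegel, §5 Lemma 5.7 (proof) p.29] [Z22 p.29, tex L1596] -/
def Ded57 : Prop :=
  MellinIdentity57 → NuSumLowerBound57 → TotientLowerBound57 → LeftSide57 → Skeleton.Lemma57

/-- The proof node of Lemma 5.7 holds (its conclusion is the tree theorem `Skeleton.lemma57_holds`).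
[cite: Zhang2022LandauSiegel, §5 Lemma 5.7 p.29] -/
theorem ded57_holds : Ded57 := fun _ _ _ _ => Skeleton.lemma57_holds

/-! ## Lemma 5.8 (p. 29, under (A)): the node `Skeleton.Lemma58`, `α₂`, and the Taylor relation -/

/-- **The hypothesis of Lemma 5.8** (DAG node `Z22:§5.u041`): "`α ≤ |s − 1| ≤ 10α`".
[cite: Zhang2022LandauSiegel, §5 Lemma 5.8 p.29] [Z22 p.29, tex L1612] -/
def InRange58 (D : ℕ) (s : ℂ) : Prop := alpha D ≤ ‖s - 1‖ ∧ ‖s - 1‖ ≤ 10 * alpha D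

/-- **`α₂ = 𝓛⁻¹⁵`** (DAG node `Z22:§5.u043`). [cite: Zhang2022LandauSiegel, §5 Lemma 5.8 p.29]
[Z22 p.29, tex L1620] -/
def alpha2 (D : ℕ) : ℝ := (ell D ^ 15)⁻¹

/-- **Lemma 5.8 restated with `InRange58` and `α₂`** (DAG nodes `Z22:Lem5.8`, `Z22:§5.u042`:
"`L(s,χ) = L′(1,χ)(s − 1) + O(α₂)`"): the banked node `Skeleton.Lemma58` unfolds to exactly this.
[cite: Zhang2022LandauSiegel, §5 Lemma 5.8 p.29] [Z22 p.29, tex L1611–L1620] -/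
theorem lemma58_iff :
    Skeleton.Lemma58 ↔ ∃ C : ℝ, ForAllLarge fun D _ χ => AssumptionA D χ → ∀ s : ℂ,
      InRange58 D s → ‖χ.LFunction s - deriv χ.LFunction 1 * (s - 1)‖ ≤ C * alpha2 D := by
  constructor
  · rintro ⟨C, D₀, h⟩
    exact ⟨C, D₀, fun D _ χ hD hq hp hA s hs => h D χ hD hq hp hA s hs.1 hs.2⟩
  · rintro ⟨C, D₀, h⟩
    exact ⟨C, D₀, fun D _ χ hD hq hp hA s h1 h2 => h D χ hD hq hp hA s ⟨h1, h2⟩⟩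

/-- **"This follows from the relation `L(s,χ) = L(1,χ) + L′(1,χ)(s−1) + ∫₁ˢ (s−w)L″(w,χ) dw`"**
(DAG node `Z22:§5.u044`; Taylor's formula with integral remainder along the segment from `1` to
`s`, `w = 1 + τ(s−1)`, `dw = (s−1)dτ`), for the real primitive character `χ` to a large modulus `D`
(so `L(s,χ)` is entire); an identity, unconditional in substance, typed in the house style under the
blanket (A). CLAIM. (Tree: the same expansion in divided-difference form,
`Zhang2022.Lemma58.LFunction_taylor_two`.) [cite: Zhang2022LandauSiegel, §5 Lemma 5.8 (proof) p.29]
[Z22 p.29, tex L1625] -/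
def TaylorIdentity58 : Prop :=
  ForAllLarge fun D _ χ => AssumptionA D χ → ∀ s : ℂ,
    χ.LFunction s = χ.LFunction 1 + deriv χ.LFunction 1 * (s - 1) +
      ∫ τ in (0 : ℝ)..1, (s - (1 + τ * (s - 1))) *
        iteratedDeriv 2 χ.LFunction (1 + τ * (s - 1)) * (s - 1)

/-- **Proof of Lemma 5.8** (DAG node `Z22:Lem5.8.pf`): "This follows from the relation [Taylor], (A)
and a simple bound for `L″(w,χ)`" — Lemma 5.8 from the Taylor relation ((A) is an antecedent inside
`Skeleton.Lemma58`). CLAIM (proof node) — a theorem since `Skeleton.Lemma58` is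
(`Skeleton.lemma58_holds`; `ded58_holds`). [cite: Zhang2022LandauSiegel, §5 Lemma 5.8 (proof) p.29]
[Z22 p.29, tex L1624] -/
def Ded58 : Prop := TaylorIdentity58 → Skeleton.Lemma58

/-- The proof node of Lemma 5.8 holds (its conclusion is the tree theorem `Skeleton.lemma58_holds`).
[cite: Zhang2022LandauSiegel, §5 Lemma 5.8 p.29] -/
theorem ded58_holds : Ded58 := fun _ => Skeleton.lemma58_holds

/-! ## Lemma 5.9 (pp. 29–30): the node `Skeleton.Lemma59 c′`, (5.16), and the six proof steps

`β₁ = iα(1 − 5c′α𝓛)` (2.13) carries the unspecified constant `c′` (`Skeleton.beta1 c′`); `ψ ∈ Ψ₁`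
(`Skeleton.PsiOne χ`); "`|s − ρ| ≫ α` for any zero `ρ`" is typed as in `Skeleton.Lemma59`:
`∀ c₀ > 0, ∃ C, …, (∀ ρ, L(ρ,ψ) = 0 → c₀α ≤ |s − ρ|) → …`. -/

/-- **The range of Lemma 5.9** (p. 29): "`|σ − 1/2| ≤ α`, `|t − 2πt₀| ≤ 𝓛₁ + 10`".
[cite: Zhang2022LandauSiegel, §5 Lemma 5.9 p.29] [Z22 p.29, tex L1632] -/
def InRange59 (D : ℕ) (s : ℂ) : Prop :=
  |s.re - 1 / 2| ≤ alpha D ∧ |s.im - 2 * π * t0 D| ≤ ell1 D + 10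

/-- **"`|s − ρ| ≫ α` for any zero `ρ` of `L(s,ψ)`"** (p. 29) with an explicit constant `c₀`:
every zero `ρ` of `L(·,ψ)` has `|s − ρ| ≥ c₀α`. [cite: Zhang2022LandauSiegel, §5 Lemma 5.9 p.29]
[Z22 p.29, tex L1632] -/
def GapCond (c₀ : ℝ) {D : ℕ} (x : Chr D) (s : ℂ) : Prop :=
  ∀ ρ : ℂ, x.ψ.LFunction ρ = 0 → c₀ * alpha D ≤ ‖s - ρ‖

/-- The zeros of `L(·,ψ)` in the open unit disc about `s′` (the range "`|ρ − s′| < 1`" of the sum in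
(5.16)). [cite: Zhang2022LandauSiegel, §5 (5.16) p.29] [Z22 p.29, (5.16), tex L1638] -/
def zerosNear {D : ℕ} (x : Chr D) (s' : ℂ) : Set ℂ := {ρ | ‖ρ - s'‖ < 1 ∧ x.ψ.LFunction ρ = 0}

/-- **(5.16)** (DAG node `Z22:(5.16)`): "It is known that
`(L′/L)(s′,ψ) = Σ_{|ρ−s′|<1} 1/(s′−ρ) + O(1/α)` for `|Re s′ − 1/2| ≤ α` and `|Im s′ − 2πt₀| < 𝓛₁ + 10`,
where `ρ` runs through the zeros of `L(s′,ψ)`" (with multiplicity — `analyticOrderNatAt`; at points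
`s′` with `L(s′,ψ) ≠ 0`; `ψ ∈ Ψ₁` as in the lemma; `1/α = (log P)/π`; under the blanket (A) of
tex L1560). CLAIM — the classical partial-fraction formula (Montgomery–Vaughan Lemma 12.1; in the
tree in disc form, `DirichletDisc.exists_norm_logDeriv_sub_sum_le`; L1 FACT-candidate FC-L1-09) at
the manuscript's parameters; no new fact.
[cite: Zhang2022LandauSiegel, §5 (5.16) p.29] [Z22 p.29–30, (5.16), tex L1638] -/
def Eq516 : Prop :=
  ∃ C : ℝ, ForAllLarge fun D _ χ => AssumptionA D χ → ∀ x ∈ PsiOne χ, ∀ s' : ℂ,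
    |s'.re - 1 / 2| ≤ alpha D → |s'.im - 2 * π * t0 D| < ell1 D + 10 → x.ψ.LFunction s' ≠ 0 →
      ‖logDeriv x.ψ.LFunction s' -
          ∑ ρ ∈ finsetOf (zerosNear x s'), (analyticOrderNatAt x.ψ.LFunction ρ : ℂ) / (s' - ρ)‖
        ≤ C / alpha D

/-- **Proof of Lemma 5.9** (DAG node `Z22:Lem5.9.pf`, pp. 29–30): Lemma 5.9 from (5.16) and
Proposition 2.2 (the proof cites "(9.1)" at tex L1651 — a mis-reference, (9.1) being §9's
`Ξ₁₂ = 2Re Θ₁ + o(𝔓)` — and "Proposition 2.2 (iii)"; (i)–(ii) are used tacitly: zeros on the critical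
line, simple), via the steps `Step59a`–`Step59f` (case `σ ≥ 1/2`; "`σ < 1/2` analogous"). CLAIM
(proof node). It concludes the BANKED node `Skeleton.Lemma59 c′`, which (unlike the antecedents
here) carries no blanket-(A) antecedent; if the skeleton owner re-types it (`Lemma59_v2`), the
wave-2 edges append re-threads this node. [cite: Zhang2022LandauSiegel, §5 Lemma 5.9 (proof) p.30]
[Z22 p.29–30, tex L1637] -/
def Ded59 (c' : ℝ) : Prop := Eq516 → Skeleton.Prop22 c' → Skeleton.Lemma59 c'

/-- **Step 1 of the proof of Lemma 5.9** (DAG node `Z22:§5.u046`): "Suppose `σ ≥ 1/2`. By (5.16),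
`−Re{(L′/L)(u + it + β₁,ψ)} < O(1/α)` for `σ < u < 1/2 + α`." CLAIM.
[cite: Zhang2022LandauSiegel, §5 Lemma 5.9 (proof) p.30] [Z22 p.30, tex L1644] -/
def Step59a (c' : ℝ) : Prop :=
  ∃ C : ℝ, ForAllLarge fun D _ χ => AssumptionA D χ → ∀ x ∈ PsiOne χ, ∀ s : ℂ,
    InRange59 D s → 1 / 2 ≤ s.re →
    ∀ u : ℝ, s.re < u → u < 1 / 2 + alpha D →
      -(logDeriv x.ψ.LFunction (u + s.im * I + beta1 c' D)).re ≤ C / alpha D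

/-- **Step 2** (DAG node `Z22:§5.u047`): "so that `log(|L(s+β₁,ψ)|/|L(1/2+α+it+β₁,ψ)|) < O(1)`"
(under "we can assume `L(s+β₁,ψ) ≠ 0`", `σ ≥ 1/2`). CLAIM.
[cite: Zhang2022LandauSiegel, §5 Lemma 5.9 (proof) p.30] [Z22 p.30, tex L1648] -/
def Step59b (c' : ℝ) : Prop :=
  ∃ C : ℝ, ForAllLarge fun D _ χ => AssumptionA D χ → ∀ x ∈ PsiOne χ, ∀ s : ℂ,
    InRange59 D s → 1 / 2 ≤ s.re →
    x.ψ.LFunction (s + beta1 c' D) ≠ 0 →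
      Real.log (‖x.ψ.LFunction (s + beta1 c' D)‖ /
          ‖x.ψ.LFunction (1 / 2 + alpha D + s.im * I + beta1 c' D)‖) ≤ C

/-- **Step 3** (DAG node `Z22:§5.u048`): "By (9.1) [sic] and the condition `|s − ρ| ≫ α` for any `ρ`,
`Re{(L′/L)(u+it,ψ)} = O(1/α)` for `σ < u < 1/2 + α`" (`σ ≥ 1/2`). CLAIM.
[cite: Zhang2022LandauSiegel, §5 Lemma 5.9 (proof) p.30] [Z22 p.30, tex L1652] -/
def Step59c : Prop :=
  ∀ c₀ : ℝ, 0 < c₀ → ∃ C : ℝ, ForAllLarge fun D _ χ => AssumptionA D χ → ∀ x ∈ PsiOne χ, ∀ s : ℂ,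
    InRange59 D s → 1 / 2 ≤ s.re → GapCond c₀ x s →
      ∀ u : ℝ, s.re < u → u < 1 / 2 + alpha D →
        |(logDeriv x.ψ.LFunction (u + s.im * I)).re| ≤ C / alpha D

/-- **Step 4** (DAG node `Z22:§5.u049`): "so that `log(|L(1/2+α+it,ψ)|/|L(s,ψ)|) < O(1)`" (`σ ≥ 1/2`,
`|s − ρ| ≫ α`). CLAIM. [cite: Zhang2022LandauSiegel, §5 Lemma 5.9 (proof) p.30] [Z22 p.30, tex L1656] -/
def Step59d : Prop :=
  ∀ c₀ : ℝ, 0 < c₀ → ∃ C : ℝ, ForAllLarge fun D _ χ => AssumptionA D χ → ∀ x ∈ PsiOne χ, ∀ s : ℂ,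
    InRange59 D s → 1 / 2 ≤ s.re → GapCond c₀ x s →
      Real.log (‖x.ψ.LFunction (1 / 2 + alpha D + s.im * I)‖ / ‖x.ψ.LFunction s‖) ≤ C

/-- **Step 5** (DAG node `Z22:§5.u050`): "Further, by (5.16) and Proposition 2.2 (iii),
`|(L′/L)(1/2+α+it′,ψ)| < (1/α)Σ_{k<1/α} 1/k + O(1/α) < (log log P)/α + O(1/α)` for `t < t′ < t + |β₁|`"
(`σ ≥ 1/2`; both printed inequalities). CLAIM. [cite: Zhang2022LandauSiegel, §5 Lemma 5.9 (proof) p.30]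
[Z22 p.30, tex L1660] -/
def Step59e (c' : ℝ) : Prop :=
  ∃ C₁ C₂ : ℝ, ForAllLarge fun D _ χ => AssumptionA D χ → ∀ x ∈ PsiOne χ, ∀ s : ℂ,
    InRange59 D s → 1 / 2 ≤ s.re →
    ∀ t' : ℝ, s.im < t' → t' < s.im + ‖beta1 c' D‖ →
      ‖logDeriv x.ψ.LFunction (1 / 2 + alpha D + t' * I)‖
          ≤ (alpha D)⁻¹ * (∑ k ∈ Finset.Ico 1 ⌈(alpha D)⁻¹⌉₊, (1 : ℝ) / k) + C₁ / alpha D ∧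
      (alpha D)⁻¹ * (∑ k ∈ Finset.Ico 1 ⌈(alpha D)⁻¹⌉₊, (1 : ℝ) / k) + C₁ / alpha D
          ≤ Real.log (Real.log (bigP D)) / alpha D + C₂ / alpha D

/-- **Step 6** (DAG node `Z22:§5.u051`): "so that
`log(|L(1/2+α+it+β₁,ψ)|/|L(1/2+α+it,ψ)|) < log log P + O(1)`" (`σ ≥ 1/2`). CLAIM. The proof ends:
"Combining these estimates we obtain the result. In the case `σ < 1/2` the proof is analogous."
[cite: Zhang2022LandauSiegel, §5 Lemma 5.9 (proof) p.30] [Z22 p.30, tex L1664] -/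
def Step59f (c' : ℝ) : Prop :=
  ∃ C : ℝ, ForAllLarge fun D _ χ => AssumptionA D χ → ∀ x ∈ PsiOne χ, ∀ s : ℂ,
    InRange59 D s → 1 / 2 ≤ s.re →
    Real.log (‖x.ψ.LFunction (1 / 2 + alpha D + s.im * I + beta1 c' D)‖ /
        ‖x.ψ.LFunction (1 / 2 + alpha D + s.im * I)‖) ≤ Real.log (Real.log (bigP D)) + C


/-! ## Wave 2 (theorem-only append): three proof steps of Lemmas 5.7 and 5.8, PROVED

`MellinIdentity57` (DAG node `Z22:§5.u039`) from the tree's Gaussian-weight Perron formula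
`GaussWeight.integral_LSeries_mul_kernel` and `ζ(s)L(s,χ) = Σ ν(n)n⁻ˢ`
(`Lemma57.LSeries_divisorSumChar`); `NuSumLowerBound57` (DAG node `Z22:§5.u040`, first `≫`) by
positivity of the real coefficients `ν(n)`, `ν(n) = 1` for `n ∣ D`, and `g(D⁴/n) ≥ g(1) = ½`;
`TaylorIdentity58` (DAG node `Z22:§5.u044`) by the fundamental theorem of calculus along the segment
`[1, s]` for the entire function `L(·,χ)`. No new facts. -/

/-- `ν = χ ∗ 1` as coefficient functions (the convolution behind `ζ(s)L(s,χ) = Σ ν(n)n⁻ˢ`).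
[cite: Zhang2022LandauSiegel, §3 p.12] -/
private theorem nu_eq_convolution {D : ℕ} [NeZero D] (χ : DirichletCharacter ℂ D) :
    nu χ = LSeries.convolution (fun n : ℕ => χ (n : ZMod D)) (1 : ℕ → ℂ) := by
  funext n
  rw [nu, LSeries.convolution_def, divisorSumChar_apply]
  simp only [Pi.one_apply, mul_one]
  exact (Nat.sum_divisorsAntidiagonal (fun i _ => χ (i : ZMod D)) (n := n)).symm

/-- `Σ ν(n)n⁻ˢ` converges absolutely for `Re s > 1`. [cite: Zhang2022LandauSiegel, §3 p.12] -/
private theorem LSeriesSummable_nu {D : ℕ} [NeZero D] (χ : DirichletCharacter ℂ D) {s : ℂ}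
    (hs : 1 < s.re) : LSeriesSummable (nu χ) s := by
  rw [nu_eq_convolution]
  exact (DirichletCharacter.LSeriesSummable_of_one_lt_re χ hs).convolution
    (LSeriesSummable_one_iff.mpr hs)

/-- **The Mellin identity of the proof of Lemma 5.7 HOLDS** (DAG node `Z22:§5.u039` PROVED):
`(1/2πi)∫_{(1)} ζ(1+s)L(1+s,χ)D^{4s}ω₁(s) ds/s = Σ_n ν(n)n⁻¹g(D⁴/n)`, by the tree's Perron formula for
the Gaussian weight (`GaussWeight.integral_LSeries_mul_kernel`, absolute convergence on `Re = 2`)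
and `Σ ν(n)n⁻ˢ = ζ(s)L(s,χ)` (`Lemma57.LSeries_divisorSumChar`); the (A) antecedent of the typed
node is not used. [cite: Zhang2022LandauSiegel, §5 Lemma 5.7 (proof) p.29] -/
theorem mellinIdentity57_holds : MellinIdentity57 := by
  refine ⟨3, fun D _ χ hD _ _ _ => ?_⟩
  have hℓ : 0 < ell D := lt_trans one_pos (one_lt_ell hD)
  have hΛ : 0 < ell D ^ 30 := by positivity
  have hD0 : (0 : ℝ) < D := by exact_mod_cast (lt_of_lt_of_le (by norm_num : 0 < 3) hD)
  have hX : 0 < (D : ℝ) ^ 4 := by positivity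
  have hs : LSeriesSummable (nu χ) (1 + ((1 : ℝ) : ℂ)) :=
    LSeriesSummable_nu χ (by norm_num)
  have key := GaussWeight.integral_LSeries_mul_kernel hΛ one_pos hX hs
  have hL : ∀ t : ℝ, LSeries (nu χ) (1 + ((1 : ℝ) + t * I))
      = riemannZeta (1 + (1 + t * I)) * χ.LFunction (1 + (1 + t * I)) := by
    intro t
    rw [ofReal_one]
    exact Lemma57.LSeries_divisorSumChar χ (by norm_num)
  have hK : ∀ t : ℝ, GaussWeight.kernel (ell D ^ 30) 1 ((D : ℝ) ^ 4) t
      = (D : ℂ) ^ (4 * (1 + (t : ℂ) * I)) * GaussWeight.omega1 (ell D ^ 30) (1 + t * I)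
          / (1 + t * I) := by
    intro t
    rw [GaussWeight.kernel, ofReal_one]
    congr 2
    rw [GaussWeight.cpow_eq_exp_log hX, ← ofReal_natCast,
      GaussWeight.cpow_eq_exp_log hD0, Real.log_pow]
    push_cast
    ring_nf
  unfold mellinLHS57 nuSum57
  have hint : (∫ t : ℝ, riemannZeta (1 + (1 + t * I)) * χ.LFunction (1 + (1 + t * I)) *
        (D : ℂ) ^ (4 * (1 + (t : ℂ) * I)) * GaussWeight.omega1 (ell D ^ 30) (1 + t * I) / (1 + t * I))
      = ∫ t : ℝ, LSeries (nu χ) (1 + ((1 : ℝ) + t * I)) *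
          GaussWeight.kernel (ell D ^ 30) 1 ((D : ℝ) ^ 4) t := by
    refine integral_congr_ae (Eventually.of_forall fun t => ?_)
    simp only [hL t, hK t]
    ring
  rw [hint, key]
  refine tsum_congr fun n => ?_
  rcases Nat.eq_zero_or_pos n with rfl | hn
  · simp [LSeries.term_zero]
  · rw [LSeries.term_of_ne_zero hn.ne', cpow_one, gW]


/-- `g(1) = 1/2` (half the Gaussian mass). [cite: Zhang2022LandauSiegel, §4 (4.1) p.18] -/
private theorem gWeight_one {Λ : ℝ} (hΛ : 0 < Λ) : GaussWeight.gWeight Λ 1 = 1 / 2 := by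
  have h := GaussWeight.gWeight_add_tail hΛ 1
  rw [Real.log_one, GaussWeight.integral_gauss_Ioi_zero, ← mul_div_assoc,
    GaussWeight.sqrt_mul_sqrt hΛ] at h
  linarith

/-- For the real character `χ`, the `n`-th term of `Σ ν(n)n⁻¹g(D⁴/n)` is the real number
`Re ν(n)·g(D⁴/n)/n`. [cite: Zhang2022LandauSiegel, §5 Lemma 5.7 (proof) p.29] -/
private theorem nuSum_term_eq {D : ℕ} [NeZero D] (χ : DirichletCharacter ℂ D) (hχ : χ ^ 2 = 1)
    (n : ℕ) : nu χ n / (n : ℂ) * (gW D ((D : ℝ) ^ 4 / n) : ℂ)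
      = (((nu χ n).re / n * gW D ((D : ℝ) ^ 4 / n) : ℝ) : ℂ) := by
  have him : (nu χ n).im = 0 := Lemma31.divisorSumChar_im_eq_zero χ hχ n
  have hre : nu χ n = ((nu χ n).re : ℂ) := by
    apply Complex.ext <;> simp [him]
  rw [hre]
  push_cast
  simp

/-- **"The right side is `≫ Σ_{n∣D} 1/n`" HOLDS** (DAG node `Z22:§5.u040`, first inequality, PROVED
with `c = 1/2`): every term `ν(n)n⁻¹g(D⁴/n)` is real and `≥ 0` (`ν(n) ≥ 0` for the real `χ`,
`Lemma57.divisorSumChar_re_nonneg`; `g > 0`), the series converges (for `n ≥ e²D⁴`,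
`g(D⁴/n) ≤ ½exp{−Λlog²(n/D⁴)} ≤ ½(D⁴/n)²` by (4.3) `GaussWeight.gWeight_le`), and for `n ∣ D`:
`ν(n) = 1` (`Lemma57.divisorSumChar_of_dvd`) and `g(D⁴/n) ≥ g(1) = ½` (`g` increasing). The (A)
antecedent of the typed node is not used. [cite: Zhang2022LandauSiegel, §5 Lemma 5.7 (proof) p.29] -/
theorem nuSumLowerBound57_holds : NuSumLowerBound57 := by
  refine ⟨1 / 2, by norm_num, 3, fun D _ χ hD hq _ _ => ?_⟩
  have hχ : χ ^ 2 = 1 := hq.sq_eq_one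
  have hℓ : 1 < ell D := one_lt_ell hD
  have hΛ : 0 < ell D ^ 30 := by positivity
  have hΛ1 : 1 ≤ ell D ^ 30 := one_le_pow₀ hℓ.le
  have hD0 : (0 : ℝ) < D := by exact_mod_cast (lt_of_lt_of_le (by norm_num : 0 < 3) hD)
  have hD4 : 0 < (D : ℝ) ^ 4 := by positivity
  -- the terms as real numbers
  set a : ℕ → ℝ := fun n => (nu χ n).re / n * gW D ((D : ℝ) ^ 4 / n) with ha
  have hterm : ∀ n : ℕ, nu χ n / (n : ℂ) * (gW D ((D : ℝ) ^ 4 / n) : ℂ) = (a n : ℂ) :=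
    fun n => nuSum_term_eq χ hχ n
  have ha0 : ∀ n : ℕ, 0 ≤ a n := by
    intro n
    have h1 : 0 ≤ (nu χ n).re := Lemma57.divisorSumChar_re_nonneg χ hχ n
    have h2 : 0 ≤ gW D ((D : ℝ) ^ 4 / n) := (GaussWeight.gWeight_pos hΛ _).le
    simp only [ha]; positivity
  have ha_le : ∀ n : ℕ, a n ≤ gW D ((D : ℝ) ^ 4 / n) := by
    intro n
    have h2 : 0 ≤ gW D ((D : ℝ) ^ 4 / n) := (GaussWeight.gWeight_pos hΛ _).le
    have h1 : (nu χ n).re / n ≤ 1 := by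
      rcases Nat.eq_zero_or_pos n with rfl | hn
      · simp
      · rw [div_le_one (by exact_mod_cast hn)]
        calc (nu χ n).re ≤ ‖nu χ n‖ := Complex.re_le_norm _
          _ ≤ 1 * n := Lemma57.norm_divisorSumChar_le_self χ n
          _ = n := one_mul _
    calc a n = (nu χ n).re / n * gW D ((D : ℝ) ^ 4 / n) := rfl
      _ ≤ 1 * gW D ((D : ℝ) ^ 4 / n) := mul_le_mul_of_nonneg_right h1 h2
      _ = _ := one_mul _
  -- summability: for `n ≥ e²D⁴`, `a n ≤ g(D⁴/n) ≤ ½exp(−Λlog²(n/D⁴)) ≤ ½(D⁴/n)²`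
  have hsum : Summable a := by
    have hg : Summable fun n : ℕ => 1 / 2 * (D : ℝ) ^ 8 * (1 / (n : ℝ) ^ 2) :=
      (Real.summable_one_div_nat_pow.mpr one_lt_two).mul_left _
    refine Summable.of_norm_bounded_eventually_nat hg ?_
    filter_upwards [eventually_ge_atTop ⌈Real.exp 2 * (D : ℝ) ^ 4⌉₊] with n hn
    have hn' : Real.exp 2 * (D : ℝ) ^ 4 ≤ n := le_trans (Nat.le_ceil _) (by exact_mod_cast hn)
    have hn0 : (0 : ℝ) < n := lt_of_lt_of_le (by positivity) hn'
    have hx0 : 0 < (D : ℝ) ^ 4 / n := by positivity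
    have hx1 : (D : ℝ) ^ 4 / n ≤ 1 := by
      rw [div_le_one hn0]
      have : (1 : ℝ) ≤ Real.exp 2 := Real.one_le_exp (by norm_num)
      nlinarith
    have hlog : 2 ≤ Real.log (n / (D : ℝ) ^ 4) := by
      rw [Real.le_log_iff_exp_le (by positivity), le_div_iff₀ hD4]
      exact hn'
    have hlog' : Real.log ((D : ℝ) ^ 4 / n) = -Real.log (n / (D : ℝ) ^ 4) := by
      rw [← Real.log_inv, inv_div]
    rw [Real.norm_of_nonneg (ha0 n)]
    calc a n ≤ gW D ((D : ℝ) ^ 4 / n) := ha_le n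
      _ ≤ 1 / 2 * Real.exp (-(ell D ^ 30) * (Real.log ((D : ℝ) ^ 4 / n)) ^ 2) :=
          GaussWeight.gWeight_le hΛ hx0 hx1
      _ ≤ 1 / 2 * Real.exp (-(2 * Real.log (n / (D : ℝ) ^ 4))) := by
          gcongr
          rw [hlog', neg_sq]
          have hL0 : 0 ≤ Real.log (n / (D : ℝ) ^ 4) := by linarith
          nlinarith [mul_le_mul_of_nonneg_right hΛ1 (sq_nonneg (Real.log (n / (D : ℝ) ^ 4)))]
      _ = 1 / 2 * ((n / (D : ℝ) ^ 4) ^ 2)⁻¹ := by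
          rw [Real.exp_neg, show (2 : ℝ) * Real.log (n / (D : ℝ) ^ 4)
              = ((2 : ℕ) : ℝ) * Real.log (n / (D : ℝ) ^ 4) by norm_num,
            Real.exp_nat_mul, Real.exp_log (by positivity)]
      _ = 1 / 2 * (D : ℝ) ^ 8 * (1 / (n : ℝ) ^ 2) := by
          field_simp
  -- the real part of the sum is the real series
  have hre : (nuSum57 χ).re = ∑' n, a n := by
    unfold nuSum57
    simp_rw [hterm]
    rw [← Complex.ofReal_tsum, Complex.ofReal_re]
  rw [hre]
  -- divisor terms: `ν(n) = 1`, `g(D⁴/n) ≥ g(1) = 1/2`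
  have hdiv : ∀ n ∈ Nat.divisors D, 1 / 2 * (1 / (n : ℝ)) ≤ a n := by
    intro n hn
    have hn0 : n ≠ 0 := Nat.ne_of_gt (Nat.pos_of_mem_divisors hn)
    have hnD : n ∣ D := Nat.dvd_of_mem_divisors hn
    have hnle : (n : ℝ) ≤ D := by exact_mod_cast Nat.le_of_dvd (Nat.pos_of_neZero D) hnD
    have hn0' : (0 : ℝ) < n := by exact_mod_cast Nat.pos_of_ne_zero hn0
    have hnu : (nu χ n).re = 1 := by
      rw [nu, Lemma57.divisorSumChar_of_dvd χ hn0 hnD, Complex.one_re]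
    have hx : (1 : ℝ) ≤ (D : ℝ) ^ 4 / n := by
      rw [le_div_iff₀ hn0', one_mul]
      have hD1 : (1 : ℝ) ≤ D := by exact_mod_cast Nat.pos_of_neZero D
      calc (n : ℝ) ≤ D := hnle
        _ = D ^ 1 := (pow_one _).symm
        _ ≤ (D : ℝ) ^ 4 := pow_le_pow_right₀ hD1 (by norm_num)
    have hg : 1 / 2 ≤ gW D ((D : ℝ) ^ 4 / n) := by
      rw [← gWeight_one hΛ]
      exact GaussWeight.gWeight_mono hΛ one_pos hx
    simp only [ha, hnu, one_div]
    rw [mul_comm]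
    exact mul_le_mul_of_nonneg_left (by simpa [one_div] using hg) (by positivity)
  calc 1 / 2 * ∑ n ∈ Nat.divisors D, (1 : ℝ) / n
      = ∑ n ∈ Nat.divisors D, 1 / 2 * (1 / (n : ℝ)) := by rw [Finset.mul_sum]
    _ ≤ ∑ n ∈ Nat.divisors D, a n := Finset.sum_le_sum hdiv
    _ ≤ ∑' n, a n := hsum.sum_le_tsum (Nat.divisors D) (fun n _ => ha0 n)

/-- Taylor's formula with integral remainder to second order along the segment `[1, s]`, for an
entire function `f`: `f(s) = f(1) + f′(1)(s−1) + ∫₀¹ (s − w(τ))f″(w(τ))(s−1) dτ`, `w(τ) = 1 + τ(s−1)`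
(FTC for `τ ↦ f(w(τ)) + f′(w(τ))(s − w(τ))`). [folklore] -/
private theorem taylor_two_segment {f : ℂ → ℂ} (hf : Differentiable ℂ f) (s : ℂ) :
    f s = f 1 + deriv f 1 * (s - 1) +
      ∫ τ in (0 : ℝ)..1, (s - (1 + τ * (s - 1))) * iteratedDeriv 2 f (1 + τ * (s - 1)) * (s - 1) := by
  set w : ℂ → ℂ := fun z => 1 + z * (s - 1) with hw
  have hf1 : Differentiable ℂ (deriv f) := by
    have h := (hf.contDiff (n := 2)).differentiable_iteratedDeriv 1 (by norm_num)
    rwa [iteratedDeriv_one] at h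
  have hf2 : iteratedDeriv 2 f = deriv (deriv f) := by
    rw [show (2 : ℕ) = 1 + 1 from rfl, iteratedDeriv_succ, iteratedDeriv_one]
  have hcont2 : Continuous (iteratedDeriv 2 f) :=
    ((hf.contDiff (n := 3)).differentiable_iteratedDeriv 2 (by norm_num)).continuous
  set H : ℂ → ℂ := fun z => f (w z) + deriv f (w z) * (s - w z) with hH
  have hwd : ∀ z : ℂ, HasDerivAt w (s - 1) z := by
    intro z
    simpa [hw] using ((hasDerivAt_id z).mul_const (s - 1)).const_add 1
  have hHd : ∀ z : ℂ, HasDerivAt H (deriv (deriv f) (w z) * (s - 1) * (s - w z)) z := by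
    intro z
    have h1 : HasDerivAt (fun z => f (w z)) (deriv f (w z) * (s - 1)) z :=
      (hf (w z)).hasDerivAt.comp z (hwd z)
    have h2 : HasDerivAt (fun z => deriv f (w z)) (deriv (deriv f) (w z) * (s - 1)) z :=
      (hf1 (w z)).hasDerivAt.comp z (hwd z)
    have h3 : HasDerivAt (fun z => s - w z) (-(s - 1)) z := by
      simpa using (hwd z).const_sub s
    have h4 := h1.add (h2.mul h3)
    refine h4.congr_deriv ?_
    ring
  have hGd : ∀ τ : ℝ, HasDerivAt (fun τ : ℝ => H τ)
      ((s - (1 + τ * (s - 1))) * iteratedDeriv 2 f (1 + τ * (s - 1)) * (s - 1)) τ := by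
    intro τ
    have h := (hHd τ).comp_ofReal
    refine h.congr_deriv ?_
    rw [hf2]
    simp only [hw]
    ring
  have hint : IntervalIntegrable
      (fun τ : ℝ => (s - (1 + τ * (s - 1))) * iteratedDeriv 2 f (1 + τ * (s - 1)) * (s - 1))
      volume 0 1 := by
    apply Continuous.intervalIntegrable
    have hwc : Continuous fun τ : ℝ => (1 : ℂ) + τ * (s - 1) := by fun_prop
    exact ((continuous_const.sub hwc).mul (hcont2.comp hwc)).mul continuous_const
  have key := intervalIntegral.integral_eq_sub_of_hasDerivAt (fun τ _ => hGd τ) hint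
  rw [key]
  simp only [hH, hw]
  push_cast
  ring

/-- **The Taylor relation of the proof of Lemma 5.8 HOLDS** (DAG node `Z22:§5.u044` PROVED): for the
(real) primitive character `χ` to a modulus `D ≥ 3`, `L(·,χ)` is entire (`χ ≠ χ₀`) and
`L(s,χ) = L(1,χ) + L′(1,χ)(s−1) + ∫₁ˢ (s−w)L″(w,χ) dw` along the segment; the (A) antecedent of the
typed node is not used. [cite: Zhang2022LandauSiegel, §5 Lemma 5.8 (proof) p.29] -/
theorem taylorIdentity58_holds : TaylorIdentity58 := by
  refine ⟨3, fun D _ χ hD _ hp _ s => ?_⟩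
  exact taylor_two_segment
    (DirichletCharacter.differentiable_LFunction (ne_one_of_isPrimitive_of_three_le hp hD)) s

end Literature.NumberTheory.LFunctions.Zhang2022.Typed.Section05C
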